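import Summits.Ventures.HodgeRepro2.T7SupportTorusProjector

/-!
# `hq` is automatic on a character: the compact-place component of the line (support, seat p1)

t7-crit-1's Record B (STATUS l. 15307): at the compact place `ι₁` the line's component is a CHARACTER of `U(W_A)(F_{ι₁})`
(L3-ARGUMENT §4a (b): `τ = Λ²(ℂ²_W) ⊗ (shift)`, a `det`-type character), so `τ(h⁻¹) u_A ∈ ℂ^× u_A` and `hq_{ι₁}` is automatic.
Abstractly: if `v` spans a `τ`-stable line, `τ(g) v = χ(g) • v` for all `g` (`χ` the character, `|χ| = 1` by unitarity),
and `v` is a `ρ_B`-weight vector of weight `q` (the matched `q`), then for EVERY `γ`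

  **`Φ_q(γ) = χ(γ) ‖v‖²`**   (`fourierCoeff_eq_of_character`),   hence `Φ_q(γ) ≠ 0` for `v ≠ 0` (`fourierCoeff_ne_zero_of_character`)

— on a character the one-vector orbital integral never vanishes: no `hq` condition and no regularity condition enters at
such a place (row 703's `P_q` is the identity on the line, `torusProj_weightVector`).

Nothing here is about any specific group, the adelic group, or any period.
Blind lane: Mathlib + the HodgeRepro2 prefix only; no sorry; axioms ⊆ {propext, Classical.choice, Quot.sound}.
-/

namespace Summit.Ventures.HodgeRepro2.T7SupportTorusProjectorCharacter

open MeasureTheory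
open scoped InnerProductSpace
open T5HaarCircle T7SupportWeightTorusOrbital T7SupportOneVectorOrbital T7SupportOneVectorBound
  T7SupportTorusProjector

variable {G : Type*} [Group G] {V : Type*} [NormedAddCommGroup V] [InnerProductSpace ℂ V]

/-- a unitary character has modulus one: `|χ(g)| = 1` on a non-zero `v` -/
theorem norm_character_eq_one {τ : G →* (V →ₗ[ℂ] V)} (hτ : IsUnitaryRep τ) {v : V} (hv : v ≠ 0) {χ : G → ℂ}
    (hχ : ∀ g, τ g v = χ g • v) (g : G) : ‖χ g‖ = 1 := by
  have h1 := norm_apply_eq hτ g v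
  rw [hχ g, norm_smul] at h1
  have hv' : ‖v‖ ≠ 0 := norm_ne_zero_iff.2 hv
  exact mul_right_cancel₀ hv' (by rw [h1, one_mul])

/-- on a `τ`-stable line the translate `τ(h⁻¹) v` is again a `ρ_B`-weight vector of weight `q` -/
theorem isWeightVector_translate {τ : G →* (V →ₗ[ℂ] V)} {ρB : Circle →* G} {q : ℤ} {v : V}
    (hv : IsWeightVector τ ρB q v) {χ : G → ℂ} (hχ : ∀ g, τ g v = χ g • v) (h : G) :
    IsWeightVector τ ρB q (τ h⁻¹ v) := by
  intro w
  rw [hχ h⁻¹, map_smul, hv w, smul_comm]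

variable [MeasurableSpace Circle] [BorelSpace Circle] [CompleteSpace V]

/-- **on a character `Φ_q(γ) = χ(γ) ‖v‖²` for every `γ`** -/
theorem fourierCoeff_eq_of_character {τ : G →* (V →ₗ[ℂ] V)} (hτ : IsUnitaryRep τ) {ρB : Circle →* G} {q : ℤ}
    {v : V} (hv : IsWeightVector τ ρB q v) {χ : G → ℂ} (hχ : ∀ g, τ g v = χ g • v) (h γ : G) :
    T7SupportOneVectorOrbital.fourierCoeff τ v h ρB q γ = χ γ * ((‖v‖ : ℝ) : ℂ) ^ 2 := by
  have hx : Continuous fun w : Circle => τ (ρB w) (τ h⁻¹ v) := by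
    have e : (fun w : Circle => τ (ρB w) (τ h⁻¹ v)) = fun w : Circle => ((w : ℂ) ^ q) • τ h⁻¹ v :=
      funext fun w => isWeightVector_translate hv hχ h w
    rw [e]
    exact ((continuous_subtype_val).zpow₀ q fun w => Or.inl (Circle.coe_ne_zero w)).smul continuous_const
  rw [fourierCoeff_eq_inner_torusProj hτ v h ρB q γ hx, torusProj_weightVector (isWeightVector_translate hv hχ h) q,
    if_pos rfl, one_smul, ← Module.End.mul_apply, ← map_mul, mul_inv_cancel_right, hχ γ, inner_smul_right,
    inner_self_eq_norm_sq_to_K]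
  rfl

/-- **on a character the one-vector orbital integral never vanishes**: `Φ_q(γ) ≠ 0` for every `γ` and `v ≠ 0` -/
theorem fourierCoeff_ne_zero_of_character {τ : G →* (V →ₗ[ℂ] V)} (hτ : IsUnitaryRep τ) {ρB : Circle →* G} {q : ℤ}
    {v : V} (hv0 : v ≠ 0) (hv : IsWeightVector τ ρB q v) {χ : G → ℂ} (hχ : ∀ g, τ g v = χ g • v) (h γ : G) :
    T7SupportOneVectorOrbital.fourierCoeff τ v h ρB q γ ≠ 0 := by
  rw [fourierCoeff_eq_of_character hτ hv hχ h γ]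
  refine mul_ne_zero ?_ ?_
  · intro h0
    have := norm_character_eq_one hτ hv0 hχ γ
    rw [h0, norm_zero] at this
    exact zero_ne_one this
  · exact pow_ne_zero _ (by exact_mod_cast norm_ne_zero_iff.2 hv0)

end Summit.Ventures.HodgeRepro2.T7SupportTorusProjectorCharacter
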